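import Mathlib

/-!
# Giorgi–Klainerman–Szeftel, Part II, §11.4 "Transport estimates for A": the printed r-WEIGHTS, as linear ℚ/ℤ-arithmetic

CITATION HEADER (lean-in-tree rule 2026-08-18).  Kernel-checked transcription of the WEIGHT bookkeeping — the exponents `w` of `r`
in the displayed integrands `∫ r^{w}|·|²` — of
* [J]  E. Giorgi, S. Klainerman, J. Szeftel, *Wave equations estimates and the nonlinear stability of slowly rotating Kerr black
  holes*, Pure Appl. Math. Q. **20** (2024) no. 7, 2865–3849 = bib key `GiorgiKlainermanSzeftel2024` — the PRIMARY text, read in the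
  held per-page text of `doi:10.4310/pamq.241128023033` (`[J] p.N Lm` = per-page file N, line m; PDF page N, printed folio N−1):
  Definition 11.2.1 and Remark 11.2.2 (p.483 L35–p.484 L27), Proposition 11.2.9 = (11.2.6)/(11.2.7) (p.486 L5–22), and the whole of
  §11.4 (p.494 L44–p.521 L52): Lemma 11.4.1 = (11.4.3), Lemma 11.4.5 = (11.4.6) + its (unnumbered) integral form, Lemma 11.4.6,
  Lemma 11.4.7, the proof of Lemma 11.4.1, Definition 11.4.8, Proposition 11.4.10 = (11.4.10) and its proof, Lemma 11.4.11 and its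
  proof, Lemma 11.4.12, Corollary 11.4.13, Lemma 11.4.14, §11.4.5; with the norms of §6.1.5, (6.1.16)–(6.1.18) (p.219 L65–115), the
  weighted derivatives `𝔡 = {∇₃, r∇₄, r∇}` (p.142 L27, p.159 L69) and the assumptions (11.1.1)–(11.1.2) (p.477 L5–17).
* [v1] = arXiv:2205.14808v1 = bib key `GiorgiKlainermanSzeftel2022`, the cell's TeX (`FinalKerrarxivversion.tex`, `l.N` = TeX line):
  Definition 11.2.1 = the `definition` l.20512–20542 with the Remark l.20544–20552, Proposition `prop:MaiTransportA-steps` l.20650–20665,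
  §11.4 = `section:transport-estimates` l.20983–22116 (Lemma `lemma:general-transport-estimate` l.21020–21039, `Lemma:div-e_3` l.21076,
  `lemma:general-transport` l.21107–21121 with proof l.21123–21163, `lemma:commutationlemmanab3nabRhat:chap11` l.21166,
  `eq:lemmageneral-transport-Rhat` l.21206–21249, the proof of the first lemma l.21253–21309, the system (11.4.8) l.21320, Definition
  `Definition:reducednormsA` l.21333–21349, Proposition `proposition:BBEEestimatesforA` l.21356–21366 with proof l.21370–21497, Lemma
  `lemma:controlofDDchotDDbccAandnab3A:chap11` l.21508–21538 with proof l.21540–21733, the elliptic lemma l.21736–21768, Corollary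
  `cor:controlofnabAandnabnab3A:chap11` l.21772–21911, Lemma `lemma:controloftheerrortermserrnabAanderrnabnab3A:chap11` l.21914–21958,
  `section:endoftheproofofprop:MaiTransportA-steps` l.21963–22116), (6.1.16)–(6.1.18) l.9939–9962, (11.1.1)–(11.1.2) =
  `eq:assumptionsonMextforpartII-1`, `…-2`, l.20240–20250.  Every display used below was read in BOTH texts; they agree except where a
  docstring says otherwise (DIVERGENCE below).
* [53] of [J] = bib key `KlainermanSzeftel2020` enters only through [J]'s pointer "following the procedure detailed in section 5.4 of
  [53]" (p.476 L14) for the iteration of §11.4.5; nothing of [53] is quoted or used.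

This is the WEIGHT twin of `FullRWInteriorLedger` (module of the same directory: the derivative LEVELS `s ≤ k_L − j` of §11.2–§11.7,
including Proposition 11.2.9's printed range) and of `DecayRateLedger` / `CollarRateLedger` (the τ-EXPONENTS).  It imports `Mathlib`
only, redeclares nothing of theirs, and does not re-type the ℂ-scalar algebra of [J] Lemma 11.1.3 (`AbarDecayInteriorLedger` §2).

WHAT IS RECORDED, and how (every `theorem` is closed by `rfl`, `decide`, `ring`, `linarith`, `norm_num`, `simp` on unfolded
definitions, `field_simp`, or a named Mathlib derivative lemma; 0 `sorry`, standard axioms).  A weight is the TOTAL exponent of `r` in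
front of a squared quantity; the outer `r^{p+1}` / `r^{p+2}` of Definition 11.2.1 and the inner `r⁴` / `r²` are added.
* §0 TABLES: Definition 11.2.1 (`B_p[A]`, `E_p[A]`; `F_p[A]` has `E_p`'s integrand), Definition 11.4.8 (`Ḃ_p[A]`), §11.4.5's
  decomposition "`B_p = Ḃ_p + ∫ r^{p+3}(r²|∇∇₃A|² + |∇A|²)`" (EXACT as finite sets of (slot, offset) pairs, `b_split`), (11.2.7)'s
  left side, Remark 11.2.2's comparison with the `𝔡`-weighted quantity (surplus `2` exactly on the `∇₃`-slots, `remark1122`), the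
  `ψ`-norms (6.1.16)/(6.1.17) (zeroth-order `Σ`-weight `min(p−2, −1−δ)`, `sigmaZero`).
* §1 THE TEMPLATE of Lemmas 11.4.1 / 11.4.5 / 11.4.7: bulk `p−3`, future boundary `p−2`, source `p−1`, conditional angular term `p−1`
  (`template`); Lemma 11.4.5's displayed algebra (`−(p−2) − 2 = −p`, the Cauchy–Schwarz exponents, `λ = p/2 ⇒ 4/p², 2/p`, the role of
  `p ≥ δ`); Lemma 11.4.6's output orders against Lemma 11.4.7's right side (EXACT matches, the threshold `O(r^{−1})Φ₁`); (W1) the proof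
  of Lemma 11.4.1 applies the integral form to `χ_nt∇̌₄Φ₁` "with `p` replaced by `p+1`" (p.500 L59, l.21268) whereas the four weights it
  then DISPLAYS (p.500 L61–91, l.21269–21277) are those of level `p+2`, which is equally admissible (`w1_level`, `w1_print`).
* §2 PROPOSITION 11.4.10: the two transport levels `p′ = p+2` (for `Ψ ∼ r²∇₃A`) and `p″ = p` (for `Φ₁ ∼ r²A`) are FORCED by Definition
  11.2.1 and are consistent across bulk / boundary / every slot (`psi_level`, `a_level`); the cascade closes because source − bulk = 2
  (`cascade`); every source weight lands EXACTLY on a table entry (`step1_sources`, `step2_sources`) — in particular the `𝔮`-source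
  `r^{p′−5}|𝔮|² = r^{p−3}|𝔮|²` is (6.1.16)'s zeroth-order weight; the pointwise conversions p.505 L123–125 / p.506 L22 slot by slot
  (`pointwise_budget`).
* §3 LEMMA 11.4.11 / 11.4.12 / COROLLARY 11.4.13: the weights `p+5`, `p+7` (`Σ`: `p+6`, `p+8`) as the Cauchy–Schwarz midpoints of
  Lemma 11.4.12 (`cs_midpoints`); every coefficient order of the two displayed identities against the tables (EXACT, `ddc_identity_budget`,
  `nab3_identity_budget`); the displayed coefficient algebra `½·(2/r) + 2·(2/r) = 5/r`, `(5/r)(1/r⁴) = 5/r⁵`, `e₄(r^{−4}) = −4r^{−5}`,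
  `5 − 4 = 1`, `r^{−4}∇₄𝔮 + r^{−5}𝔮 = r^{−5}e₄(r𝔮)` (`five_over_r`, `W2_coefficient`, `e4_rq_grouping`) — (W2) three displays print
  `5/r` where this algebra and the next display's `1/r⁵ + O(ar^{−6})` force `5/r⁵` (p.510 L22–31, L60–73, L84–96 = l.21620, 21633,
  21649; both texts); the `Σ`-weight `r^{p+8}·r^{−10} = r^{p−2}` on `|e₄(r𝔮)|²` is EXACTLY (6.1.17)'s top-order weight in both regimes
  and the `O(r^{−6})𝔮` remainder is lower order iff `p ≤ 3−δ` (`e4rq_weights`).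
* §4 LEMMA 11.4.14: the printed weights `7−δ, 9−δ, 8−δ, 10−δ` are the top-of-range values `p = 2−δ` (`err_top_weights`); the reduction
  to `∫ dr/r^{1+δ}` needs the δ-FREE squared decay totals `8, 10` (`Σ`: `9, 11`) (`err_budget`); the exponent sums of the structural
  reductions p.517 L43–54 (`err_structure`); `∫_{τ₁}^{∞} τ^{−3−3δ_dec}dτ ∝ τ₁^{−2−3δ_dec}`'s exponent and the finiteness condition of
  `∫_{r₊(1−δ_H)}^{∞} dr/r^{1+δ}` (`err_integrals`).  The τ-rates of this lemma are NOT recorded (they use the decay of `A`, Theorem M?,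
  beyond (11.1.2); see `DecayRateLedger`).
* §5 §11.4.5 AND (11.2.7): `E_p = Ė_p`, `F_p = Ḟ_p`, `B_p = Ḃ_p + …` (§0); the `Σ`-estimate for `∇₃∇̌₃A` (p.519 L13–31): its three
  weights are EXACT table entries for `p ≤ 1−δ` (`s0_sigma33`); the HEADLINE: the exponent `min(4, 5−δ−p)` of (11.2.7) is EXACTLY the
  largest inner weight `w` for which the `𝔮`-term `r^{p+2+w−8}|𝔮|²` produced by `|∇₃∇̌₃A| ≲ r^{−4}|𝔮| + …` sits inside `E_p[𝔮]`'s
  zeroth-order `Σ`-weight `min(p−2, −1−δ)` of (6.1.17) — equality in BOTH regimes, the crossover `p = 1−δ` being (6.1.17)'s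
  (`w1127_origin`, `w1127_max`, `w1127_regimes`); the iteration's commuted sources are lower order (`iteration_sources`).

PRINT DATA met (none affects Proposition 11.2.9): (W1) §1; (W2) §3; (W4) the equation number (11.4.7) is PRINTED on the display of
Lemma 11.4.7 (p.499 L13–39, [v1] `eq:precise-transport-Rhat`) while all four textual uses "(11.4.7)" (p.498 L6, p.499 L93, p.500 L5,
p.500 L59) mean the UNNUMBERED integral form of Lemma 11.4.5 (p.497 L2–39) — in [v1] that display is `\bea\label{eq:general-integrated-
estimate-e3}` + `\nn…` (l.21118–21120): the `\nonumber` inside the labelled row makes `\eqref` resolve to the next equation number;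
recorded in the docstring of `template` only (no arithmetic content).  (W3, our reading, no arithmetic content beyond §0's χ-flag)
Lemma 11.4.11's and Corollary 11.4.13's FIRST `Σ`-estimates (p.507 L19–45, p.514 L17–40) carry no `𝔮`-energy on their right sides,
whereas removing `χ_nt` from `E_p[A]`'s `∇₄∇₃A`-slot on `Σ ∩ {χ_nt < 1}` goes through `∇₃∇̌₃A = O(r^{−4})𝔮 + …` (p.519 L2–12, where the
text does it with `E_p[𝔮] ⊆ EB_p[ψ]` at hand, p.519 L40–47); immaterial downstream (p.518 L45–49 carries `E_p[𝔮](τ)`).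
DIVERGENCE [v1] → [J] (recorded, not adjudicated): [v1] Definition l.21333–21349 defines `Ḃ_p`, `Ė_p`, `Ḟ_p` with `Ė_p = E_p`,
`Ḟ_p = F_p` verbatim (same integrands as Definition 11.2.1); [J] Definition 11.4.8 (p.502 L39–65) keeps only `Ḃ_p` and writes `E_p`,
`F_p` in (11.4.9), (11.4.10), Lemma 11.4.11 (p.507 L36, L88) — but retains the clause "where `χ_nt = χ_nt(r)` denotes a smooth cut-off
…" (p.502 L59–60), which no longer refers to anything in Definition 11.4.8, and the symbols `Ė_p` (p.513 L22, p.518 L34) and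
"`F_p[A] = Ḟ_p[A]`, `E_p[A] = Ė_p[A]`" (p.518 L35), undefined in [J].  [v1] (11.2.7) l.20663 prints `\Ab` (A̲, `\def\Ab`, l.242) in two of its
four slots and l.22102 once more ("with `A` replaced with `(𝓛̸_T, q𝒟̄̌·, ∇̌₄, χ_red∇̌₃)A̲`"), where the `s = 0` conclusion l.22039–22045, Definition
11.2.1 and [J] (p.486 L14–21, p.521 L41) print `A` (glyph; [J]'s underline would not be extractable; recorded as a [v1] observation).

NOT RECORDED (deliberately): any estimate, norm as an analytic object, frame, region or PDE — `B_p`, `E_p`, `Ψ`, `𝔮`, `A`, `Γ_g` appear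
only inside quotation marks and as slot LABELS; the LEVELS `s ≤ k_L` of Proposition 11.2.9 (`FullRWInteriorLedger`); the divergence
theorem (11.4.4), the boundary signs of Remark 11.4.3, the commutator formulas of Lemma 4.2.2 / Corollary A.1.1, the elliptic estimate
of Lemma 11.4.12 and the Hodge estimates of the iteration — the text's analysis is taken as printed; where the text names a step
without displaying its arithmetic the label [our reading] marks arithmetic WE supply that the printed numbers obey.

STATUS-RELATION.  Adds nothing to and changes nothing of any landed module; Proposition 11.2.9 stays a verbatim leaf of the cell's DAG.
-/

namespace Literature.Geometry.Lorentzian.GiorgiKlainermanSzeftel2022.TransportWeightLedger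

/-! ## §0 The weight tables of Definition 11.2.1, Definition 11.4.8, (11.2.7), Remark 11.2.2, (6.1.16)–(6.1.17)

Slots (labels only): `0 = |A|²`, `1 = |∇₃A|²`, `2 = |∇₄A|²`, `3 = |∇A|²`, `4 = |∇₃∇̌₃A|²`, `5 = |∇₄∇₃A|²`, `6 = |∇∇₃A|²`,
`7 = |∇_R̂∇₃A|²`, `8 = χ²_nt|∇₄∇₃A|²` (the cut-off slot of the boundary norms).  A table is a finite set of pairs (slot, offset), the
weight being `r^{p + offset}`. -/

/-- Definition 11.2.1, `B_p[A](τ₁,τ₂) = ∫_{M(τ₁,τ₂)} r^{p+1}(r⁴|∇₃∇̌₃A|² + r⁴|∇₄∇₃A|² + r⁴|∇∇₃A|² + r²|∇₃A|² + r²|∇₄A|² + r²|∇A|² +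
|A|²)`: offsets `5,5,5,3,3,3,1` on slots `4,5,6,1,2,3,0`.
[cite: GiorgiKlainermanSzeftel2024, Definition 11.2.1, p.483 L35–45; GiorgiKlainermanSzeftel2022, l.20512–20518] -/
def normB : Finset (ℕ × ℤ) := {(4, 5), (5, 5), (6, 5), (1, 3), (2, 3), (3, 3), (0, 1)}

/-- Definition 11.2.1, `E_p[A](τ) = ∫_{Σ(τ)} r^{p+2}(r⁴χ²_nt|∇₄∇₃A|² + r²|∇_R̂∇₃A|² + r²|∇₃A|² + r²|∇₄A|² + |A|²)` (and `F_p[A]`, same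
integrand over `A ∪ Σ_*`): offsets `6,4,4,4,2` on slots `8,7,1,2,0`.  In [v1] this is also, verbatim, `Ė_p[A]` / `Ḟ_p[A]` of Definition
l.21338–21341 (dropped in [J] Definition 11.4.8; see the module docstring, DIVERGENCE).
[cite: GiorgiKlainermanSzeftel2024, Definition 11.2.1, p.483 L46–60; GiorgiKlainermanSzeftel2022, l.20519–20524, l.21338–21343] -/
def normE : Finset (ℕ × ℤ) := {(8, 6), (7, 4), (1, 4), (2, 4), (0, 2)}

/-- Definition 11.4.8, `Ḃ_p[A](τ₁,τ₂) = ∫ r^{p+1}(r⁴|∇₃∇̌₃A|² + r⁴|∇₄∇₃A|² + r²|∇₃A|² + r²|∇₄A|² + |A|²)` ("partial norms for `A` which do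
not provide control for angular derivatives"): `normB` without the slots `6 = |∇∇₃A|²`, `3 = |∇A|²`.
[cite: GiorgiKlainermanSzeftel2024, Definition 11.4.8, p.502 L37–60; GiorgiKlainermanSzeftel2022, `Definition:reducednormsA`, l.21333–21337] -/
def normBdot : Finset (ℕ × ℤ) := {(4, 5), (5, 5), (1, 3), (2, 3), (0, 1)}

/-- §11.4.5: "`B_p[A](τ₁,τ₂) = Ḃ_p[A](τ₁,τ₂) + ∫_{M(τ₁,τ₂)} r^{p+3}(r²|∇∇₃A|² + |∇A|²)`" — the angular piece: offsets `5, 3` on slots `6, 3`.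
[cite: GiorgiKlainermanSzeftel2024, §11.4.5, p.518 L35–40; GiorgiKlainermanSzeftel2022, l.21989–21992] -/
def extraB : Finset (ℕ × ℤ) := {(6, 5), (3, 3)}

/-- (11.2.7) at `s = 0`, left side `∫_{Σ(τ)} r^{p+2}(r^{min(4,5−δ−p)}|∇₃∇̌₃A|² + r⁴|∇₄∇₃A|² + r⁴|∇∇₃A|² + r²|∇A|²)`: the three slots with a
`p`-independent offset, `6, 6, 4` on slots `5, 6, 3` (the first slot is treated in §5, `w1127`).
[cite: GiorgiKlainermanSzeftel2024, (11.2.7), p.486 L11–21, p.519 L42–48; GiorgiKlainermanSzeftel2022, l.20660–20665, l.22039–22045] -/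
def norm1127rest : Finset (ℕ × ℤ) := {(5, 6), (6, 6), (3, 4)}

/-- §11.4.5's decomposition is EXACT on the tables: `B_p`'s table is the disjoint union of `Ḃ_p`'s and of the angular piece; and the slots
missing from `Ḃ_p` are precisely the two angular ones (Remark 11.4.9 "do not contain angular derivatives").
[cite: GiorgiKlainermanSzeftel2024, p.518 L35–40, Remark 11.4.9, p.502 L69–70; GiorgiKlainermanSzeftel2022, l.21989–21992, l.21351–21353] -/
theorem b_split : normB = normBdot ∪ extraB ∧ normBdot ∩ extraB = ∅ ∧
    (normB.image Prod.fst) \ (normBdot.image Prod.fst) = {6, 3} := by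
  decide

/-- (11.2.7)'s three `p`-independent `Σ`-weights are the BULK offsets of the same slots in `B_p[A]` plus one (`Σ` carries one power of
`r` more than `M`, as `E_p`'s outer `r^{p+2}` against `B_p`'s `r^{p+1}`), and of them only slot `5` (as the cut-off slot `8`) is already
in `E_p[A]` — Remark 11.2.2: "Additional derivatives in `E_p[A](τ)` and `F_p[A](τ₁,τ₂)` are missing as well …, with the exception of the
ones recovered in (11.2.7)".
[cite: GiorgiKlainermanSzeftel2024, (11.2.7), p.486 L11–21, Remark 11.2.2, p.484 L15–19; GiorgiKlainermanSzeftel2022, l.20660–20665, l.20546–20548] -/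
theorem e1127_offsets : norm1127rest = ((normB.filter fun x => x.1 = 5 ∨ x.1 = 6 ∨ x.1 = 3).image fun x => (x.1, x.2 + 1)) ∧
    (norm1127rest.image Prod.fst) ∩ (normE.image Prod.fst) = ∅ ∧ ((8, (6 : ℤ)) ∈ normE ∧ (5, (6 : ℤ)) ∈ norm1127rest) := by
  decide

/-- The weighted derivatives `𝔡 = {∇₃, r∇₄, r∇}` (p.142 L27): inner `r`-offset `0` on `∇₃`, `2` on `∇₄` and on `∇` (squared).  Remark
11.2.2's display "`∫ r^{p+1}(r²|𝔡^{≤s+1}∇₃A|² + |𝔡^{≤s+1}A|²) ≲ B^s_p[A]`, but the norm `B^s_p[A]` is in fact stronger in powers of `r`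
for the `∇₃` derivative": the top-order pieces of the left side have weights `p+3+0, p+3+2, p+3+2` (slots `4,5,6`) and `p+1+0, p+1+2,
p+1+2` (slots `1,2,3`); `B_p`'s offsets exceed these by EXACTLY `2` on the two `∇₃`-slots `4, 1` and by `0` on the four others.
[cite: GiorgiKlainermanSzeftel2024, Remark 11.2.2, p.484 L19–26, p.142 L27, p.159 L69; GiorgiKlainermanSzeftel2022, l.20544–20552, l.6495, l.7244] -/
theorem remark1122 :
    let dk : Finset (ℕ × ℤ) := {(4, 3 + 0), (5, 3 + 2), (6, 3 + 2), (1, 1 + 0), (2, 1 + 2), (3, 1 + 2)}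
    (∀ x ∈ dk, ∀ y ∈ normB, x.1 = y.1 → (y.2 - x.2 = 2 ↔ (x.1 = 4 ∨ x.1 = 1)) ∧ (y.2 - x.2 = 0 ↔ ¬ (x.1 = 4 ∨ x.1 = 1))) ∧
    dk.image Prod.fst ⊆ normB.image Prod.fst := by
  decide

/-- (6.1.16): "`B_p[ψ](τ₁,τ₂) := Morr[ψ](τ₁,τ₂) + ∫_{M_{r≥4m}(τ₁,τ₂)} r^{p−3}(|𝔡ψ|² + |ψ|²)`" — bulk weights for `ψ`: zeroth order `p−3`,
`|∇₄ψ|²` and `|∇ψ|²` at `p−3+2 = p−1`, `|∇₃ψ|²` at `p−3`. [cite: GiorgiKlainermanSzeftel2024, (6.1.16), p.219 L65–73; GiorgiKlainermanSzeftel2022, l.9939–9941] -/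
def bPsiZero (p : ℚ) : ℚ := p - 3

/-- Unfolding lemma for `bPsiZero`. [cite: GiorgiKlainermanSzeftel2024, (6.1.16), p.219 L65–73] -/
@[simp] lemma bPsiZero_def (p : ℚ) : bPsiZero p = p - 3 := rfl

/-- (6.1.17): "`E_p[ψ](τ) := E[ψ] + ∫_{Σ_{r≥4m}(τ)} r^{p}(|∇₄ψ|² + r^{−2}|ψ|²)` for `p ≤ 1−δ`, `:= E[ψ] + ∫_{Σ_{r≥4m}(τ)} r^{p}(|r^{−1}∇₄(rψ)|² +
r^{−p−1−δ}|ψ|²)` for `p > 1−δ`."  The zeroth-order `Σ`-weight is `p−2` in the first regime and `p−p−1−δ = −1−δ` in the second; as one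
expression, `min(p−2, −1−δ)` (`sigmaZero_regimes`). [cite: GiorgiKlainermanSzeftel2024, (6.1.17), p.219 L75–101; GiorgiKlainermanSzeftel2022, l.9946–9951] -/
def sigmaZero (δ p : ℚ) : ℚ := min (p - 2) (-1 - δ)

/-- Unfolding lemma for `sigmaZero`. [cite: GiorgiKlainermanSzeftel2024, (6.1.17), p.219 L75–101] -/
@[simp] lemma sigmaZero_def (δ p : ℚ) : sigmaZero δ p = min (p - 2) (-1 - δ) := rfl

/-- (6.1.17)'s two regimes: the printed zeroth-order weights `r^{p}·r^{−2}` (`p ≤ 1−δ`) and `r^{p}·r^{−p−1−δ}` (`p > 1−δ`) are `p−2` and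
`−1−δ`; they agree at the crossover `p = 1−δ`; `min(p−2, −1−δ)` is the first iff `p ≤ 1−δ` and the second iff `1−δ ≤ p`; and the
top-order weight is `p` on `|∇₄ψ|²` resp. `p−2` on `|∇₄(rψ)|²` (`= r^{p}·r^{−2}`).
[cite: GiorgiKlainermanSzeftel2024, (6.1.17), p.219 L75–101; GiorgiKlainermanSzeftel2022, l.9946–9951] -/
theorem sigmaZero_regimes (δ p : ℚ) :
    p + (-2) = p - 2 ∧ p + (-p - 1 - δ) = -1 - δ ∧ ((1 - δ) - 2 = -1 - δ) ∧
    (p ≤ 1 - δ ↔ sigmaZero δ p = p - 2) ∧ (1 - δ ≤ p ↔ sigmaZero δ p = -1 - δ) ∧ p + (-2) = p - 2 := by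
  refine ⟨by ring, by ring, by ring, ?_, ?_, by ring⟩
  · simp only [sigmaZero_def]
    constructor
    · intro h; exact min_eq_left (by linarith)
    · intro h; have := min_le_right (p - 2) (-1 - δ); rw [h] at this; linarith
  · simp only [sigmaZero_def]
    constructor
    · intro h; exact min_eq_right (by linarith)
    · intro h; have := min_le_left (p - 2) (-1 - δ); rw [h] at this; linarith

/-! ## §1 The template: Lemma 11.4.1 (11.4.3), Lemma 11.4.5 (11.4.6) and its integral form, Lemmas 11.4.6 / 11.4.7, the proof of Lemma 11.4.1 -/

/-- BULK weight of the transport template: "`∫_{M(τ₁,τ₂)} r^{p−3}|Φ₁|²`" (integral form of Lemma 11.4.5, p.497 L2–39; (11.4.3), p.495 L17–20).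
[cite: GiorgiKlainermanSzeftel2024, Lemma 11.4.5, p.497 L2–39; GiorgiKlainermanSzeftel2022, `eq:general-integrated-estimate-e3`, l.21117–21120] -/
def wBulk (p : ℚ) : ℚ := p - 3

/-- FUTURE-BOUNDARY weight: "`∫_{∂M⁺(τ₁,τ₂)} r^{p−2}|Φ₁|²`", `∂M⁺ = A ∪ Σ(τ₂) ∪ Σ_*` (p.495 L51–52); also the initial term on `Σ(τ₁)`.
[cite: GiorgiKlainermanSzeftel2024, Lemma 11.4.5, p.497 L2–39, p.495 L51–52; GiorgiKlainermanSzeftel2022, l.21117–21120, l.21035–21038] -/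
def wBdry (p : ℚ) : ℚ := p - 2

/-- SOURCE weight: "`∫_{M(τ₁,τ₂)} r^{p−1}|Φ₂|²`". [cite: GiorgiKlainermanSzeftel2024, Lemma 11.4.5, p.497 L27–37; GiorgiKlainermanSzeftel2022, l.21117–21120] -/
def wSrc (p : ℚ) : ℚ := p - 1

/-- Unfolding lemma for `wBulk`. [cite: GiorgiKlainermanSzeftel2024, p.497 L2–39] -/
@[simp] lemma wBulk_def (p : ℚ) : wBulk p = p - 3 := rfl
/-- Unfolding lemma for `wBdry`. [cite: GiorgiKlainermanSzeftel2024, p.497 L2–39] -/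
@[simp] lemma wBdry_def (p : ℚ) : wBdry p = p - 2 := rfl
/-- Unfolding lemma for `wSrc`. [cite: GiorgiKlainermanSzeftel2024, p.497 L2–39] -/
@[simp] lemma wSrc_def (p : ℚ) : wSrc p = p - 1 := rfl

/-- THE TEMPLATE (Lemma 11.4.5's integral form, p.497 L2–39 — printed WITHOUT an equation number in [J] and cited there as "(11.4.7)"
at p.498 L6, p.499 L93, p.500 L5, L59, while the number (11.4.7) is printed on Lemma 11.4.7's display p.499 L31 (W4, recorded only
here); Lemma 11.4.1 = (11.4.3), p.495 L17–49,
has the same three outer weights with inner `r²` on the `∇₃`, `χ_nt∇₄` slots; in [v1] the integral form's row is `\bea\label{…}` +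
`\nn…`, l.21118–21120, so `\eqref` picks up the next number): boundary − bulk = 1, source − bulk = 2, source −
boundary = 1; and (11.4.3)'s CONDITIONAL term "`(a²+ε²)∫ r^{p−1}|∇Φ₁|²`" (Remark 11.4.2) sits at the source weight = the bulk weight of a
DERIVATIVE slot (`p−3+2`), i.e. it is of top order, not lower order — whence "conditional".  From `|q| ∼ r`: `r|q|^{p−4} ∼ r^{p−3}`,
`r^{−1}|q|^{p} ∼ r^{p−1}`, `|q|^{p−2} ∼ r^{p−2}` ((11.4.6) → integral form).
[cite: GiorgiKlainermanSzeftel2024, Lemma 11.4.5, (11.4.6), p.496 L64–88, p.497 L2–39, (11.4.3), p.495 L8–54; GiorgiKlainermanSzeftel2022, `lemma:general-transport`, l.21107–21121, `lemma:general-transport-estimate`, l.21020–21039] -/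
theorem template (p : ℚ) :
    wBdry p - wBulk p = 1 ∧ wSrc p - wBulk p = 2 ∧ wSrc p - wBdry p = 1 ∧ wSrc p = wBulk p + 2 ∧
    (1 + (p - 4) = wBulk p ∧ -1 + p = wSrc p ∧ wBdry p + 0 = p - 2) := by
  refine ⟨?_, ?_, ?_, ?_, ?_, ?_, ?_⟩ <;> simp only [wBulk_def, wBdry_def, wSrc_def] <;> ring

/-- Lemma 11.4.5, the displayed algebra of its proof (p.497 L41–119): "`−e₃(|q|^{p−2})|Φ₁|² = (p−2)r|q|^{p−4}|Φ₁|²`" combined with Lemma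
11.4.4's "`Div(f e₃) = e₃(f) + (−2r/|q|² + Γ_b)f`" gives the coefficient `−(p−2) − 2 = −p` of `r|q|^{p−4}|Φ₁|²` (p.497 L80–88); the
Cauchy–Schwarz split "`2ℜ((λr)^{−1/2}|q|^{p/2}Φ₂ · (λr)^{1/2}|q|^{p/2−2}Φ̄₁) ≤ λr|q|^{p−4}|Φ₁|² + λ^{−1}r^{−1}|q|^{p}|Φ₂|²`" (L100–101) is
exponent-consistent; "choosing `λ = p/2`" leaves `p − λ = p/2` on the left, and dividing by it turns `λ^{−1}` into `4/p²` and the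
divergence's `1` into `2/p` — the printed constants of (11.4.6) "`r|q|^{p−4}|Φ₁|² ≲ (4/p²)r^{−1}|q|^{p}|Φ₂|² − (2/p)Div(|q|^{p−2}|Φ₁|²e₃)`".
[cite: GiorgiKlainermanSzeftel2024, Lemma 11.4.4, p.496 L28–57, Lemma 11.4.5, (11.4.6), p.496 L71–88, p.497 L41–119, p.498 L5; GiorgiKlainermanSzeftel2022, `Lemma:div-e_3`, l.21076–21082, l.21107–21121, l.21123–21163] -/
theorem lemma1145_algebra (p : ℚ) (hp : p ≠ 0) :
    (-(p - 2) - 2 = -p) ∧ ((-1 : ℚ) / 2 + 1 / 2 = 0 ∧ p / 2 + (p / 2 - 2) = p - 2 ∧ 2 * (p / 2 - 2) = p - 4 ∧ 2 * (p / 2) = p) ∧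
    (p - p / 2 = p / 2 ∧ (p / 2)⁻¹ / (p / 2) = 4 / p ^ 2 ∧ 1 / (p / 2) = 2 / p) := by
  refine ⟨by ring, ⟨by norm_num, by ring, by ring, by ring⟩, ⟨by ring, ?_, ?_⟩⟩
  · field_simp; ring
  · field_simp

/-- "Therefore, for `p ≥ δ`, choosing `λ = p/2`, we infer, for `ε` sufficiently small" (p.497 L104): the role of the hypothesis `p ≥ δ`
of Lemmas 11.4.1 / 11.4.5 / 11.4.7 is a UNIFORM lower bound for the coefficient `p − λ − O(ε) = p/2 − Cε` left after absorbing
"`O(ε)r|q|^{p−4}|Φ₁|²`" (L103): with `Cε ≤ δ/4` it is at least `δ/4 > 0` for every `p ≥ δ` [our reading of "sufficiently small"; the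
inequality is arithmetic].  The same hypothesis is what every later application checks ("`p′ ≥ 2+δ > δ`", p.503 L62; "`p+1 > p ≥ δ`",
p.500 L59). [cite: GiorgiKlainermanSzeftel2024, p.497 L102–105, p.500 L59, p.503 L62; GiorgiKlainermanSzeftel2022, l.21156, l.21268, l.21391] -/
theorem p_ge_delta_role (p δ C ε : ℚ) (hδ : 0 < δ) (hp : δ ≤ p) (hε : C * ε ≤ δ / 4) :
    δ / 4 ≤ p - p / 2 - C * ε ∧ 0 < p - p / 2 - C * ε := by
  constructor <;> linarith

/-- Lemma 11.4.6 (p.498 L10–16; p.499 L2–9): "`[∇₃, ((r²+a²)/|q|²)∇_R̂]U = O((a,ε)r^{−1})∇U + O(r^{−1}[ε])∇₄U + O(r^{−2})∇₃U + O(r^{−3})U`"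
([v1] prints the `ε` in the second coefficient, l.21170; [J]'s extraction cannot show it), and the commuted equation of Lemma 11.4.7's
proof "`∇̌₃(…∇_R̂Φ₁) = O((a,ε)r^{−1})∇Φ₁ + O(r^{−1}[ε])∇₄Φ₁ + O(r^{−1})Φ₁ + O(r^{−2})Φ₂ + O(1)∇_R̂Φ₂`" (p.499 L84–92).  Fed into the
template's SOURCE weight `p−1` (each coefficient `r^{−c}` costs `2c`), the five terms land at `p−3`, `p−3`, `p−3`, `p−5`, `p−1` = EXACTLY
Lemma 11.4.7's printed right side "`(a²+ε²)∫ r^{p−3}|∇Φ₁|²`", "`ε²∫ r^{p−3}|∇₄Φ₁|²`", the template's own bulk weight for `|Φ₁|²` (whence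
"Together with (11.4.7)", p.500 L5), four powers BELOW the source weight for `|Φ₂|²`, and the source weight for `|∇_R̂Φ₂|²` (p.499
L11–39, L94–119).  The zeroth-order coefficient `O(r^{−c})Φ₁` is affordable iff `p−1−2c ≤ p−3`, i.e. iff `c ≥ 1`: the printed `O(r^{−1})Φ₁`
is the threshold case. [cite: GiorgiKlainermanSzeftel2024, Lemma 11.4.6, p.498 L10–16, Lemma 11.4.7, p.499 L11–39, L47–119, p.500 L5–41; GiorgiKlainermanSzeftel2022, `lemma:commutationlemmanab3nabRhat:chap11`, l.21166–21204, `eq:lemmageneral-transport-Rhat`, l.21206–21249] -/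
theorem lemma1147_sources (p c : ℚ) :
    (wSrc p - 2 * 1 = wBulk p ∧ wSrc p - 2 * 1 = p - 3 ∧ wSrc p - 2 * 2 = wSrc p - 4 ∧ wSrc p - 2 * 0 = wSrc p) ∧
    (wSrc p - 2 * c ≤ wBulk p ↔ 1 ≤ c) := by
  simp only [wSrc_def, wBulk_def]
  refine ⟨⟨by ring, by ring, by ring, by ring⟩, ?_⟩
  constructor <;> intro h <;> linarith

/-- (W1) Proof of Lemma 11.4.1 (p.500 L43–91; l.21253–21277).  The commuted equation "`∇̌₃(χ_nt∇̌₄Φ₁) = χ_nt∇̌₄Φ₂ + O(1)∂_rχ_nt∇_R̂Φ₁ +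
O(1)∂_rχ_ntΦ₂ + O((a+ε)r^{−1})∇̌Φ₁ + O(r^{−3})Φ₁`" is fed to the integral form "with `p` replaced by `p+1`" (p.500 L59, l.21268), and
the text then DISPLAYS (p.500 L61–91, l.21269–21277) bulk `r^{p−3}·r²χ²|∇₄Φ₁|²`, boundary `r^{p−2}·r²χ²|∇₄Φ₁|²`, source
`r^{p−1}·r²χ²|∇₄Φ₂|²` and conditional term `(a²+ε²)r^{p−1}|∇Φ₁|²`.  At template level `t` applied to `χ_nt∇̌₄Φ₁` these four weights are
`t−3`, `t−2`, `t−1`, `t−1−2`; they equal the displayed ones iff `t = p+2` (each of the four equations alone forces it), while `t = p+1`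
lands one power of `r` BELOW each displayed weight.  Level `p+2` is admissible exactly as `p+1` is ("`p+1 > p ≥ δ`": `p+2 > p ≥ δ`), so
the display, which is what (11.4.3) states and what §11.4.3 uses, stands; the remaining source `O(r^{−3})Φ₁` lands at `p+1−6 = p−5 ≤
p−3`.  Recorded, not adjudicated.
[cite: GiorgiKlainermanSzeftel2024, proof of Lemma 11.4.1, p.500 L43–91, (11.4.3), p.495 L17–49; GiorgiKlainermanSzeftel2022, l.21253–21309, l.21026–21039] -/
theorem w1_level (p t : ℚ) :
    ((wBulk t = wBulk p + 2 ↔ t = p + 2) ∧ (wBdry t = wBdry p + 2 ↔ t = p + 2) ∧ (wSrc t = wSrc p + 2 ↔ t = p + 2) ∧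
      (wSrc t - 2 = wSrc p ↔ t = p + 2)) ∧
    (wBulk (p + 1) = wBulk p + 2 - 1 ∧ wBdry (p + 1) = wBdry p + 2 - 1 ∧ wSrc (p + 1) = wSrc p + 2 - 1) ∧
    (wSrc (p + 2) - 6 = p - 5 ∧ p - 5 ≤ wBulk p) := by
  simp only [wBulk_def, wBdry_def, wSrc_def]
  refine ⟨⟨?_, ?_, ?_, ?_⟩, ⟨by ring, by ring, by ring⟩, ⟨by ring, by linarith⟩⟩ <;>
    constructor <;> intro h <;> linarith

/-- (W1, the printed justification carries over verbatim) "`Since p+1 > p ≥ δ`" (p.500 L59): for `p ≥ δ` both `p+1` and `p+2` exceed `δ`.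
[cite: GiorgiKlainermanSzeftel2024, p.500 L59; GiorgiKlainermanSzeftel2022, l.21268] -/
theorem w1_print (p δ : ℚ) (hp : δ ≤ p) : δ < p + 1 ∧ δ < p + 2 ∧ p < p + 1 ∧ p + 1 < p + 2 := by
  refine ⟨by linarith, by linarith, by linarith, by linarith⟩

/-! ## §2 Proposition 11.4.10 (p.502 L72–p.506 L81): the two transport levels and every source weight -/

/-- STEP 1 (p.503 L2–112): Lemma 11.4.1 applied to `Φ₁ = Ψ` at level `p′`, where "`Ψ = (|q|⁴/(4r²))∇̌₃A + rΓ_g·A + …`" (p.505 L94–120),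
i.e. `|Ψ|² ∼ r⁴|∇₃A|²`, `|∇₄Ψ|² ∼ r⁴|∇₄∇₃A|² + …`.  Matching the template's bulk zeroth slot `r^{p′−3}|Ψ|² ∼ r^{p′+1}|∇₃A|²` with `B_p[A]`'s
`r^{p+3}|∇₃A|²` FORCES "`We choose p′ = p+2`" (p.503 L62), and the same `p′` then matches every other slot EXACTLY: bulk `r^{p′−3}·r²|∇₄Ψ|²
→ p+5` (slot 5 of `B_p`), boundary `r^{p′−2}|Ψ|² → p+4`, `r^{p′−2}·r²χ²|∇₄Ψ|² → p+6`, `r^{p′−2}|∇_R̂Ψ|² → p+4` (slots 1, 8, 7 of `E_p`); and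
"`p′ ≥ 2+δ > δ` in that case" for `p ≥ δ`.
[cite: GiorgiKlainermanSzeftel2024, proof of Proposition 11.4.10, p.503 L2–112, p.505 L94–123, Definition 11.2.1, p.483 L35–60; GiorgiKlainermanSzeftel2022, l.21370–21410, l.21391, l.21450–21470] -/
theorem psi_level (p p' δ : ℚ) :
    (wBulk p' + 4 = p + 3 ↔ p' = p + 2) ∧
    (wBulk (p + 2) + 2 + 4 = p + 5 ∧ wBdry (p + 2) + 4 = p + 4 ∧ wBdry (p + 2) + 2 + 4 = p + 6 ∧ wBdry (p + 2) + 0 + 4 = p + 4) ∧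
    (δ ≤ p → 2 + δ ≤ p + 2 ∧ δ < p + 2 ∨ δ < 0) ∧
    ((4, (5 : ℤ)) ∈ normB ∧ (5, (5 : ℤ)) ∈ normB ∧ (1, (3 : ℤ)) ∈ normB ∧ (1, (4 : ℤ)) ∈ normE ∧ (8, (6 : ℤ)) ∈ normE ∧
      (7, (4 : ℤ)) ∈ normE) := by
  simp only [wBulk_def, wBdry_def]
  refine ⟨?_, ⟨by ring, by ring, by ring, by ring⟩, fun h => Or.inl ⟨by linarith, by linarith⟩, by decide⟩
  constructor <;> intro h <;> linarith

/-- STEP 1's SOURCES at `p′ = p+2` (p.503 L7–11, L24–30, L47–60, L73–112; p.504 L5–31 = (11.4.11)): `Φ₂ = O(r^{−2})𝔮 + O(rε)∇₃A + O(ε)A`.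
The `𝔮`-term: `r^{p′−1}·r^{−4} = r^{p′−5} = r^{p−3}` on `|𝔮|²` and `|∇_R̂𝔮|²`, `r^{p−1}` on `χ²|∇₄𝔮|²` — EXACTLY (6.1.16)'s zeroth-order bulk
weight `p−3` and its `|r∇₄ψ|²`-weight `p−3+2` ("In view of the definition of … `B_p[𝔮]`", p.504 L5); the `ε∇₃A`-term: `r^{p′−1}·r² =
r^{p+3}` = `B_p[A]`'s slot-1 weight EXACTLY (so only the smallness of `ε²` absorbs it, "`+ ε²Ḃ_p[A]`", p.504 L25); the `εA`-term:
`r^{p′−1} = r^{p+1}` = slot 0 EXACTLY; the conditional term `(a²+ε²)r^{p′−1}|∇Ψ|² = (a²+ε²)r^{p+1}|∇Ψ|²` (p.504 L24–26), which with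
`|∇Ψ|² ∼ r⁴|∇∇₃A|²` is (11.4.10)'s "`(a²+ε²)∫ r^{p+3}·r²|∇∇₃A|²`" (p.502 L79–80): `p+1+4 = p+5`.
[cite: GiorgiKlainermanSzeftel2024, p.503 L7–112, (11.4.11), p.504 L5–31, (11.4.10), p.502 L72–83, (6.1.16), p.219 L65–73; GiorgiKlainermanSzeftel2022, l.21370–21410, `eq:transport-estimate-no-angular`, l.21359–21365, l.9939–9941] -/
theorem step1_sources (p : ℚ) :
    (wSrc (p + 2) - 4 = bPsiZero p ∧ wSrc (p + 2) - 4 + 2 = bPsiZero p + 2 ∧ bPsiZero p + 2 = p - 1) ∧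
    (wSrc (p + 2) + 2 = p + 3 ∧ wSrc (p + 2) + 0 = p + 1) ∧ (wSrc (p + 2) = p + 1 ∧ p + 1 + 4 = p + 5 ∧ p + 5 = (p + 3) + 2) := by
  simp only [wSrc_def, bPsiZero_def]
  refine ⟨⟨by ring, by ring, by ring⟩, ⟨by ring, by ring⟩, ⟨by ring, by ring, by ring⟩⟩

/-- STEP 2 (p.504 L33–110): Lemma 11.4.1 applied to `Φ₁ = ((tr X̄)̄²/((ℜ tr X̄)²(tr X̄)²))A ∼ r²A`, `Φ₂ = Ψ + r²𝔡^{≤1}(Γ_b)·A = Ψ + O(rε)A`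
"for `p ≥ δ`", i.e. at level `p″ = p` — FORCED by matching `r^{p″−3}|Φ₁|² ∼ r^{p″+1}|A|²` with `B_p[A]`'s `r^{p+1}|A|²`, and then consistent
on every slot: bulk `r^{p−3}·r⁴(r²|∇₃A|² + r²|∇₄A|² + |A|²) = r^{p+1}(…)` (p.504 L51–57 — slots 1, 2, 0 at `p+3, p+3, p+1`), boundary
`r^{p−2}·r⁴ = r^{p+2}` (L59–72 — `E_p`'s slots 2, 0 at `p+4, p+2`).
[cite: GiorgiKlainermanSzeftel2024, p.504 L33–110, Definition 11.2.1, p.483 L35–60; GiorgiKlainermanSzeftel2022, l.21412–21438] -/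
theorem a_level (p p'' : ℚ) :
    (wBulk p'' + 4 = p + 1 ↔ p'' = p) ∧
    (wBulk p + 4 + 2 = p + 3 ∧ wBulk p + 4 = p + 1 ∧ wBdry p + 4 + 2 = p + 4 ∧ wBdry p + 4 = p + 2) ∧
    ((1, (3 : ℤ)) ∈ normB ∧ (2, (3 : ℤ)) ∈ normB ∧ (0, (1 : ℤ)) ∈ normB ∧ (2, (4 : ℤ)) ∈ normE ∧ (0, (2 : ℤ)) ∈ normE) := by
  simp only [wBulk_def, wBdry_def]
  refine ⟨?_, ⟨by ring, by ring, by ring, by ring⟩, by decide⟩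
  constructor <;> intro h <;> linarith

/-- THE CASCADE: step 2's source is step 1's unknown `Ψ`, and the template's source weight at level `p` EQUALS its bulk weight at level
`p+2` — "`∫ r^{p−1}(r²χ²|∇₄Ψ|² + |∇_R̂Ψ|² + |Ψ|²)`" on step 2's right (p.504 L79–80) is the left side of (11.4.11) (p.504 L8) — precisely
because source − bulk = 2 (`template`); a two-step transport cascade closes with level gap `g` iff `g = 2`.
[cite: GiorgiKlainermanSzeftel2024, p.504 L5–31, L73–88, p.505 L43–57; GiorgiKlainermanSzeftel2022, l.21402–21449] -/
theorem cascade (p g : ℚ) : wSrc p = wBulk (p + 2) ∧ (wSrc p = wBulk (p + g) ↔ g = 2) := by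
  simp only [wSrc_def, wBulk_def]
  refine ⟨by ring, ?_⟩
  constructor <;> intro h <;> linarith

/-- STEP 2's SOURCES at level `p` (p.504 L73–110): the `εrA`-term `r^{p−1}·r²·(r²χ²|∇₄A|² + |∇_R̂A|² + |A|²)` = "`ε²∫ r^{p+1}(r²χ²|∇₄A|² +
|∇_R̂A|² + |A|²)`" (L99–105): slots 2, 0 at `p+3`, `p+1` = `B_p[A]`'s EXACTLY (absorbed by the smallness of `ε²` only); the conditional
term `(a²+ε²)r^{p−1}·r⁴|∇A|² = (a²+ε²)r^{p+3}|∇A|²` (L101–109) = (11.4.10)'s "`(a²+ε²)∫ r^{p+3}|∇A|²`" = `B_p`'s slot 3 EXACTLY.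
[cite: GiorgiKlainermanSzeftel2024, p.504 L73–110, (11.4.10), p.502 L79–80; GiorgiKlainermanSzeftel2022, l.21416–21449, l.21359–21365] -/
theorem step2_sources (p : ℚ) :
    (wSrc p + 2 + 2 = p + 3 ∧ wSrc p + 2 + 0 = p + 1) ∧ wSrc p + 4 = p + 3 ∧
    ((2, (3 : ℤ)) ∈ normB ∧ (0, (1 : ℤ)) ∈ normB ∧ (3, (3 : ℤ)) ∈ normB) := by
  simp only [wSrc_def]
  refine ⟨⟨by ring, by ring⟩, by ring, by decide⟩

/-- THE POINTWISE CONVERSIONS `Ψ ↔ ∇₃A` (p.505 L123–125, p.506 L22): "`|∇₃A| ≲ r^{−2}|Ψ| + r^{−1}|A|`, `|∇₄∇₃A| ≲ r^{−2}|∇₄Ψ| + r^{−3}|Ψ| +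
r^{−1}|∇₄A| + r^{−2}|A|`, `|∇_R̂∇₃A| ≲ r^{−2}|∇_R̂Ψ| + r^{−2}|Ψ| + r^{−1}|∇_R̂A| + r^{−1}|A|`, `|∇₃∇̌₃A| ≲ r^{−4}|𝔮| + r^{−1}|∇₃A| + r^{−2}|A|`."
Placed at the TABLE weights of their left sides (slots 1: `p+3`; 5: `p+5`; 7: `p+4` on `Σ`; 4: `p+5`), every right-side term lands on
a weight ALREADY CONTROLLED, all but two exactly: slot 1 → `r^{p−1}|Ψ|²` (bulk of step 1) and `r^{p+1}|A|²`; slot 5 → `r^{p+1}|∇₄Ψ|²`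
(`= r^{p−1}·r²`), `r^{p−1}|Ψ|²`, `r^{p+3}|∇₄A|²`, `r^{p+1}|A|²`; slot 7 → `r^{p}|∇_R̂Ψ|²`, `r^{p}|Ψ|²` (boundary of step 1), `r^{p+2}|∇_R̂A|²`
(two below `E_p`'s slot 2), `r^{p+2}|A|²`; slot 4 → `r^{p−3}|𝔮|²` = (6.1.16)'s zeroth-order weight, `r^{p+3}|∇₃A|²`, `r^{p+1}|A|²`.
(The analogous `Σ`-weight for slot 4, `p+6`, is NOT in `E_p[A]` — that slot is what (11.2.7) recovers, §5.)
[cite: GiorgiKlainermanSzeftel2024, p.505 L94–125, p.506 L5–51; GiorgiKlainermanSzeftel2022, l.21450–21497] -/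
theorem pointwise_budget (p : ℚ) :
    ((p + 3) - 4 = wBulk (p + 2) ∧ (p + 3) - 2 = p + 1) ∧
    ((p + 5) - 4 = wBulk (p + 2) + 2 ∧ (p + 5) - 6 = wBulk (p + 2) ∧ (p + 5) - 2 = p + 3 ∧ (p + 5) - 4 = p + 1) ∧
    ((p + 4) - 4 = wBdry (p + 2) ∧ (p + 4) - 4 = wBdry (p + 2) + 0 ∧ (p + 4) - 2 = p + 2) ∧
    ((p + 5) - 8 = bPsiZero p ∧ (p + 5) - 2 = p + 3 ∧ (p + 5) - 4 = p + 1) ∧ ((4, (6 : ℤ)) ∉ normE) := by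
  simp only [wBulk_def, wBdry_def, bPsiZero_def]
  refine ⟨⟨by ring, by ring⟩, ⟨by ring, by ring, by ring, by ring⟩, ⟨by ring, by ring, by ring⟩, ⟨by ring, by ring, by ring⟩, by decide⟩

/-! ## §3 Lemma 11.4.11, Lemma 11.4.12, Corollary 11.4.13 (p.506 L83–p.516) -/

/-- WHERE `p+5`, `p+7`, `p+6`, `p+8` COME FROM.  Corollary 11.4.13's proof (p.514 L73–135) applies Lemma 11.4.12 "`∫_S(|∇U|² + r^{−2}|U|²)
≲ |∫_S U·𝒟̂⊗(𝒟̄·U)| + O(a…)∫_S r^{−2}|(∇₃,∇₄)U|²`" (p.513 L29–47) with the weight of the TARGET slot and splits the product by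
Cauchy–Schwarz: "`∫ r^{p+3}|∇A|² ≲ ∫ r^{p+1}|A|² + ∫ r^{p+5}|𝒟̂⊗(𝒟̄·A)|² + (a²+ε²)∫ r^{p+1}|(∇₃,∇₄)A|²`" (p.514 L94–135) — `p+3` is the
midpoint of `p+1` (slot 0 of `B_p`) and `p+5`; likewise `p+5 = ½((p+3) + (p+7))` for `∇∇₃A` against `r^{p+3}|∇₃A|²` (slot 1), and on `Σ`
`p+4 = ½((p+2)+(p+6))`, `p+6 = ½((p+4)+(p+8))`; the `a`-terms land two powers below the table (`p+3−2 = p+1 ≤ p+3`).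
[cite: GiorgiKlainermanSzeftel2024, Lemma 11.4.12, p.513 L29–47, Corollary 11.4.13, p.514 L7–135, p.515–516; GiorgiKlainermanSzeftel2022, l.21736–21768, l.21772–21911] -/
theorem cs_midpoints (p : ℚ) :
    ((p + 1) / 2 + (p + 5) / 2 = p + 3 ∧ (p + 3) / 2 + (p + 7) / 2 = p + 5 ∧ (p + 2) / 2 + (p + 6) / 2 = p + 4 ∧
      (p + 4) / 2 + (p + 8) / 2 = p + 6) ∧
    ((p + 3) - 2 = p + 1 ∧ p + 1 ≤ p + 3 ∧ (p + 5) - 2 = p + 3) ∧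
    ((0, (1 : ℤ)) ∈ normB ∧ (1, (3 : ℤ)) ∈ normB ∧ (3, (3 : ℤ)) ∈ normB ∧ (6, (5 : ℤ)) ∈ normB ∧ (0, (2 : ℤ)) ∈ normE ∧
      (1, (4 : ℤ)) ∈ normE) := by
  refine ⟨⟨by ring, by ring, by ring, by ring⟩, ⟨by ring, by linarith, by ring⟩, by decide⟩

/-- Lemma 11.4.11, FIRST identity (Proposition 5.1.1; p.507 L100–p.508 L34): "`¼𝒟̂⊗(𝒟̄·A) = ∇̌₄∇̌₃A + O(r^{−1})∇̌₃A + O(r^{−1})∇̌₄A +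
O(ar^{−2})∇̌A + O(r^{−2})A + Err_{∇A}`."  At the bulk weight `p+5` (boundary `p+6`) each coefficient `r^{−c}` costs `2c`: the five terms land
at `p+5, p+3, p+3, p+1, p+1` (`Σ`: one more each) = slots 5, 1, 2 of `Ḃ_p[A]` EXACTLY, the printed "`a²∫ r^{p+1}|∇A|²`" (p.507 L9–10;
`Σ`: "`a²∫_Σ r^{p+2}|∇A|²`", L30–36) and slot 0 EXACTLY — "in view of the definition of the norms `BEḞ_p[A]`" (p.508 L36–37).  On `Σ` the
slot-5 weight `p+6` is `E_p[A]`'s CUT-OFF slot 8 (`χ²_nt`), not an unrestricted slot (W3, module docstring).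
[cite: GiorgiKlainermanSzeftel2024, Lemma 11.4.11, p.507 L2–49, p.507 L100–p.508 L80; GiorgiKlainermanSzeftel2022, `lemma:controlofDDchotDDbccAandnab3A:chap11`, l.21508–21523, l.21540–21570] -/
theorem ddc_identity_budget (p : ℚ) :
    ((p + 5) - 2 * 0 = p + 5 ∧ (p + 5) - 2 * 1 = p + 3 ∧ (p + 5) - 2 * 2 = p + 1) ∧
    ((p + 6) - 2 * 0 = p + 6 ∧ (p + 6) - 2 * 1 = p + 4 ∧ (p + 6) - 2 * 2 = p + 2) ∧
    ((5, (5 : ℤ)) ∈ normBdot ∧ (1, (3 : ℤ)) ∈ normBdot ∧ (2, (3 : ℤ)) ∈ normBdot ∧ (0, (1 : ℤ)) ∈ normBdot ∧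
      (8, (6 : ℤ)) ∈ normE ∧ (5, (6 : ℤ)) ∉ normE ∧ (1, (4 : ℤ)) ∈ normE ∧ (2, (4 : ℤ)) ∈ normE ∧ (0, (2 : ℤ)) ∈ normE) := by
  refine ⟨⟨by ring, by ring, by ring⟩, ⟨by ring, by ring, by ring⟩, by decide⟩

/-- Lemma 11.4.11, the displayed coefficient algebra of the SECOND identity (p.508 L81–p.511 L45; l.21571–21670).  Differentiating
"`−(−½ tr X − 2 tr X̄)∇̌₃A`" by `∇̌₃`, with "`tr X = 2/r + O(ar^{−2}) + Γ_g`" (p.509 L3–12), gives the leading coefficient `½·(2/r) + 2·(2/r) =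
5/r` of `∇̌₃∇̌₃A` (p.509 L36, L74; l.21592, 21607).
[cite: GiorgiKlainermanSzeftel2024, p.508 L81–p.509 L80; GiorgiKlainermanSzeftel2022, l.21571–21610] -/
theorem five_over_r (r : ℝ) (hr : r ≠ 0) : (1 / 2) * (2 / r) + 2 * (2 / r) = 5 / r := by
  field_simp; ring

/-- (W2) Substituting "`∇̌₃²A = (1/r⁴ + O(ar^{−5}))𝔮 + O(r^{−1})∇̌₃A + …`" (the definition of `𝔮`; p.509 L81–90, l.21611–21614)
into `(5/r + O(ar^{−2}))∇̌₃∇̌₃A` gives `(5/r⁵ + O(ar^{−6}))𝔮`: main term `(5/r)(1/r⁴) = 5/r⁵`, cross terms `(5/r)(a/r⁵) = 5a/r⁶` and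
`(a/r²)(1/r⁴) = a/r⁶`.  The text PRINTS "`(5/r + O(ar^{−6}))𝔮`" (p.510 L22–31, l.21620) and then "`(5/r + O(ar^{−2}))𝔮`" twice (p.510
L60–73, L84–96; l.21633, l.21649) — the error term of the first is that of `5/r⁵`, and the NEXT display (p.511 L12–37, l.21642–21663),
applying `∇̌₄` to `∇̌₃²A`'s `(1/r⁴)𝔮` and adding, prints "`(1/r⁴ + O(ar^{−5}))∇̌₄𝔮 + (1/r⁵ + O(ar^{−6}))𝔮`", whose `1/r⁵` is `5/r⁵ + e₄(1/r⁴)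
= 5/r⁵ − 4/r⁵` (`e4_rq_grouping`): both force `5/r⁵` in the three displays.  Identical in both texts; immaterial (the final line p.511
L43–45 = l.21668–21670 is correct).  Recorded, not adjudicated.
[cite: GiorgiKlainermanSzeftel2024, p.509 L81–90, p.510 L1–101, p.511 L1–45; GiorgiKlainermanSzeftel2022, l.21611–21694] -/
theorem W2_coefficient (r a : ℝ) (hr : r ≠ 0) :
    (5 / r) * (1 / r ^ 4) = 5 / r ^ 5 ∧ (5 / r) * (a / r ^ 5) = 5 * a / r ^ 6 ∧ (a / r ^ 2) * (1 / r ^ 4) = a / r ^ 6 ∧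
    (5 : ℝ) / r ^ 5 + (-4) / r ^ 5 = 1 / r ^ 5 ∧ (5 : ℝ) - 4 = 1 ∧ ((5 : ℝ) / r = 5 / r ^ 5 ↔ r ^ 4 = 1) := by
  refine ⟨by field_simp, by field_simp, by field_simp, by field_simp; ring, by norm_num, ?_⟩
  rw [div_eq_div_iff hr (pow_ne_zero 5 hr)]
  constructor
  · intro h
    have h' : r * (r ^ 4 - 1) = 0 := by linear_combination (1 / 5 : ℝ) * h
    rcases mul_eq_zero.mp h' with h0 | h1
    · exact absurd h0 hr
    · linarith
  · intro h
    linear_combination 5 * r * h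

/-- `∇̌₄` acting on the radial coefficient and the GROUPING (p.511 L2–45; l.21642–21670): `e₄(r^{−4}) = −4r^{−5}` (with `e₄(r) = 1`, the
outgoing normalisation of the chapter — an idealisation of "`e₄(r) = 1 + O(…)`" [our reading]), so the `𝔮`-coefficient after `∇̌₄` is
`5/r⁵ − 4/r⁵ = 1/r⁵`, and then "`(1/r⁴)∇̌₄𝔮 + (1/r⁵)𝔮 = O(r^{−5})e₄(r𝔮)`" EXACTLY, by Leibniz `e₄(r𝔮) = r e₄(𝔮) + 𝔮`: for a differentiable
scalar model `f` of `𝔮` along `e₄`, `d/dx (x f(x)) = f + x f′` and `x^{−4}f′ + x^{−5}f = x^{−5}(x f′ + f)`.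
[cite: GiorgiKlainermanSzeftel2024, p.511 L1–45, p.512 L5–45; GiorgiKlainermanSzeftel2022, l.21642–21721] -/
theorem e4_rq_grouping (r : ℝ) (hr : r ≠ 0) (f : ℝ → ℝ) (f' : ℝ) (hf : HasDerivAt f f' r) :
    HasDerivAt (fun x : ℝ => x ^ (-4 : ℤ)) ((-4 : ℝ) * r ^ (-4 - 1 : ℤ)) r ∧
    HasDerivAt (fun x : ℝ => x * f x) (1 * f r + r * f') r ∧
    r ^ (-4 : ℤ) * f' + r ^ (-5 : ℤ) * f r = r ^ (-5 : ℤ) * (r * f' + f r) := by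
  refine ⟨?_, (hasDerivAt_id' r).mul hf, ?_⟩
  · simpa using hasDerivAt_zpow (-4 : ℤ) r (Or.inl hr)
  · have h5 : r ^ (-5 : ℤ) * r = r ^ (-4 : ℤ) := by
      rw [show (-4 : ℤ) = -5 + 1 by norm_num, zpow_add_one₀ hr]
    calc r ^ (-4 : ℤ) * f' + r ^ (-5 : ℤ) * f r = (r ^ (-5 : ℤ) * r) * f' + r ^ (-5 : ℤ) * f r := by rw [h5]
      _ = r ^ (-5 : ℤ) * (r * f' + f r) := by ring

/-- Lemma 11.4.11, SECOND identity's budget (p.511 L39–45, p.512 L5–45, "This yields, … in view of the definition of the norms `BEḞ_p[A]`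
and `B_p[𝔮]`", p.512 L46–p.513 L24): "`¼∇̌₃𝒟̂⊗(𝒟̄·A) = O(r^{−5})e₄(r𝔮) + O(r^{−6})𝔮 + O(r^{−1})∇₄∇₃A + O(ar^{−2})∇∇₃A + O(r^{−2})∇₃A +
O(r^{−2})∇₄A + O(ar^{−2})∇A + O(r^{−3})A + Err_{∇∇₃A}`" at bulk weight `p+7` / boundary weight `p+8`.  The `A`-terms land at `p+5` (slot 5),
`a²(p+3)` = the printed "`a²∫ r^{p+3}(|∇∇₃A|² + |∇A|²)`" (p.507 L57–58; `Σ`: "`a²∫_Σ r^{p+4}(…)`", L84), `p+3, p+3` (slots 1, 2), `a²(p+3)`,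
`p+1` (slot 0) — all EXACT; the `𝔮`-terms: bulk `r^{p+7−10}|e₄(r𝔮)|² = r^{p−3}|e₄(r𝔮)|² ≲ r^{p−1}|∇₄𝔮|² + r^{p−3}|𝔮|²` = (6.1.16)'s weights
EXACTLY, and `r^{p+7−12}|𝔮|² = r^{p−5}`, two below; on `Σ`: `r^{p+8−10} = r^{p−2}` on `|e₄(r𝔮)|²`, which is EXACTLY (6.1.17)'s top-order
weight in BOTH regimes (`r^{p}|∇₄ψ|² + r^{p−2}|ψ|²` for `p ≤ 1−δ`; `r^{p}|r^{−1}∇₄(rψ)|² = r^{p−2}|∇₄(rψ)|²` for `p > 1−δ`), and `r^{p+8−12} =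
r^{p−4}` on `|𝔮|²`, inside (6.1.17)'s zeroth-order weight `min(p−2, −1−δ)` iff `p ≤ 3−δ` — true on the whole range `p ≤ 2−δ`.
[cite: GiorgiKlainermanSzeftel2024, Lemma 11.4.11, p.507 L50–99, p.511 L39–45, p.512 L5–p.513 L27, (6.1.16)–(6.1.17), p.219 L65–101; GiorgiKlainermanSzeftel2022, l.21524–21537, l.21695–21733, l.9939–9951] -/
theorem nab3_identity_budget (p δ : ℚ) :
    ((p + 7) - 2 * 1 = p + 5 ∧ (p + 7) - 2 * 2 = p + 3 ∧ (p + 7) - 2 * 3 = p + 1 ∧ (p + 8) - 2 * 2 = p + 4) ∧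
    ((p + 7) - 10 = bPsiZero p ∧ bPsiZero p + 2 = p - 1 ∧ (p + 7) - 12 = bPsiZero p - 2) ∧
    ((p + 8) - 10 = p - 2 ∧ (p - 2) + 2 = p ∧ p + (-2) = p - 2 ∧ (p + 8) - 12 = p - 4 ∧ (p - 4 ≤ sigmaZero δ p ↔ p ≤ 3 - δ) ∧
      (p ≤ 2 - δ → p - 4 ≤ sigmaZero δ p)) ∧
    ((5, (5 : ℤ)) ∈ normBdot ∧ (1, (3 : ℤ)) ∈ normBdot ∧ (2, (3 : ℤ)) ∈ normBdot ∧ (0, (1 : ℤ)) ∈ normBdot ∧ (6, (5 : ℤ)) ∈ extraB ∧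
      (3, (3 : ℤ)) ∈ extraB) := by
  simp only [bPsiZero_def, sigmaZero_def, le_min_iff]
  refine ⟨⟨by ring, by ring, by ring, by ring⟩, ⟨by ring, by ring, by ring⟩, ⟨by ring, by ring, by ring, by ring, ?_, ?_⟩, by decide⟩
  · constructor
    · rintro ⟨-, h⟩; linarith
    · intro h; constructor <;> linarith
  · intro h; constructor <;> linarith

/-- `e4rq_weights`: the `Σ`-weight bookkeeping of the previous docstring in the two regimes of (6.1.17) separately, as printed — regime
`p ≤ 1−δ`: `|e₄(r𝔮)|² ≤ 2r²|∇₄𝔮|² + 2|𝔮|²` puts `r^{p−2}|e₄(r𝔮)|²` on the weights `p` and `p−2` of "`r^{p}(|∇₄ψ|² + r^{−2}|ψ|²)`"; regime `p > 1−δ`: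
`r^{p−2}|e₄(r𝔮)|² = r^{p}|r^{−1}∇₄(r𝔮)|²` verbatim.  Either way no power of `r` is lost or spare: the weight `p+8` of Lemma 11.4.11 is the
LARGEST `Σ`-weight on `|𝒟̂⊗(𝒟̄·∇₃A)|²` that `E_p[𝔮]` affords (`w + (−10) ≤ p − 2 ↔ w ≤ p + 8`).
[cite: GiorgiKlainermanSzeftel2024, p.507 L67–95, p.513 L2–24, (6.1.17), p.219 L75–101; GiorgiKlainermanSzeftel2022, l.21529–21533, l.9946–9951] -/
theorem e4rq_weights (p w : ℚ) :
    ((p - 2) + 2 = p + 0 ∧ (p - 2) + 0 = p + (-2)) ∧ ((p - 2) = p + (-2) ∧ p + (-2) + 0 = p - 2) ∧ (w + (-10) ≤ p - 2 ↔ w ≤ p + 8) := by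
  refine ⟨⟨by ring, by ring⟩, ⟨by ring, by ring⟩, ?_⟩
  constructor <;> intro h <;> linarith

/-! ## §4 Lemma 11.4.14 (p.517 L2–108; l.21914–21958): the r-side of the error-term estimate -/

/-- "Using the bootstrap assumptions for `Γ_g`, `Γ_b`, `A` and `B`, we infer, for all `s ≤ k_L`, `∫_M r^{7−δ}|𝔡^sErr_{∇A}|² + ∫_M
r^{9−δ}|𝔡^sErr_{∇∇₃A}|² ≲ ε⁴∫_{τ₁}^{∞}dτ/τ^{3+3δ_dec} ∫_{r≥r₊(1−δ_H)} dr/r^{1+δ} ≲ ε₀²τ₁^{−2−3δ_dec}` and `∫_Σ r^{8−δ}|…|² + ∫_Σ r^{10−δ}|…|² ≲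
ε⁴τ^{−2−3δ_dec}∫ dr/r^{1+δ}`" (p.517 L55–107), for the lemma's weights `r^{p+5}, r^{p+7}` (`Σ`: `r^{p+6}, r^{p+8}`) "for all `δ ≤ p ≤ 2−δ`"
(L4–34): the four printed exponents are the values at the TOP of the range `p = 2−δ`, and for `p ≤ 2−δ` and `r ≥ 1` the weight `r^{p+k}`
is dominated by `r^{2−δ+k}` (exponent comparison) [our reading of why only the top weight is displayed].
[cite: GiorgiKlainermanSzeftel2024, Lemma 11.4.14, p.517 L4–34, L55–108; GiorgiKlainermanSzeftel2022, l.21914–21958] -/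
theorem err_top_weights (p δ : ℚ) :
    ((2 - δ) + 5 = 7 - δ ∧ (2 - δ) + 7 = 9 - δ ∧ (2 - δ) + 6 = 8 - δ ∧ (2 - δ) + 8 = 10 - δ) ∧
    (p ≤ 2 - δ → p + 5 ≤ 7 - δ ∧ p + 7 ≤ 9 - δ ∧ p + 6 ≤ 8 - δ ∧ p + 8 ≤ 10 - δ) := by
  refine ⟨⟨by ring, by ring, by ring, by ring⟩, fun h => ⟨by linarith, by linarith, by linarith, by linarith⟩⟩

/-- THE δ-FREE DECAY BUDGETS.  To turn `r^{W}|X|²` into the printed `dr/r^{1+δ}` the squared pointwise `r`-decay of `X` together with the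
`r`-power of the volume element must total `W + (1+δ)`; for the four printed weights these totals are the INTEGERS `8, 10` (bulk:
`Err_{∇A}`, `Err_{∇∇₃A}`) and `9, 11` (`Σ`) — the `δ` of the weight and the `δ` of `dr/r^{1+δ}` cancel.  (Which branch of (11.1.1), `|Γ_g| ≲
εr^{−2}τ^{−1/2−δ_dec}` or `εr^{−1}τ^{−1−δ_dec}`, the text uses per factor, and the τ-rates, are not displayed and NOT recorded; cf.
`DecayRateLedger`.)
[cite: GiorgiKlainermanSzeftel2024, p.517 L55–108, (11.1.1)–(11.1.2), p.477 L5–17; GiorgiKlainermanSzeftel2022, l.21946–21958, l.20240–20250] -/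
theorem err_budget (δ : ℚ) :
    (7 - δ) + (1 + δ) = 8 ∧ (9 - δ) + (1 + δ) = 10 ∧ (8 - δ) + (1 + δ) = 9 ∧ (10 - δ) + (1 + δ) = 11 ∧
    ((9 - δ) - (7 - δ) = 2 ∧ (10 - δ) - (8 - δ) = 2 ∧ (8 - δ) - (7 - δ) = 1) := by
  refine ⟨by ring, by ring, by ring, by ring, ⟨by ring, by ring, by ring⟩⟩

/-- THE STRUCTURAL REDUCTIONS (p.517 L36–54): from "`Err_{∇A} = Γ_g·∇₃A + r^{−1}𝔡^{≤1}Γ_g·(A,B) + Γ_b·Γ_g·A`", "`Err_{∇∇₃A} = r^{−4}Γ_g·𝔮 +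
r^{−1}𝔡^{≤1}Γ_g·(∇₃A,∇₃B) + r^{−2}𝔡^{≤2}Γ_b·(A,B) + 𝔡^{≤1}(Γ_b·Γ_g·A)`", the Bianchi identities "`∇₃A = O(r^{−1})𝔡^{≤1}B + O(r^{−1})A + r^{−3}Γ_g`,
`∇₃B = r^{−2}𝔡^{≤1}Γ_g`" and "`𝔮 ∈ r𝔡^{≤2}Γ_g`" the text infers "`Err_{∇A} = r^{−1}𝔡^{≤1}Γ_g·(A,B) + r^{−3}Γ_g·Γ_g + Γ_b·Γ_g·A`", "`Err_{∇∇₃A} =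
r^{−3}𝔡^{≤2}Γ_g·Γ_g + r^{−2}𝔡^{≤2}Γ_b·(A,B) + 𝔡^{≤1}(Γ_b·Γ_g·A)`".  The `r`-orders add as printed: `0+(−1) = −1`, `0+(−3) = −3` (from
`Γ_g·∇₃A`); `−4+1 = −3` (from `r^{−4}Γ_g·𝔮`); `−1+(−1) = −2`, `−1+(−3) = −4 ≤ −3`, `−1+(−2) = −3` (from `r^{−1}Γ_g·∇₃(A,B)`, using `Γ_g ⊆ Γ_b`
for the first).  [cite: GiorgiKlainermanSzeftel2024, p.517 L36–54, p.507 L47–49, L96–99; GiorgiKlainermanSzeftel2022, l.21926–21945] -/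
theorem err_structure :
    ((0 : ℤ) + (-1) = -1 ∧ (0 : ℤ) + (-3) = -3) ∧ ((-4 : ℤ) + 1 = -3) ∧
    ((-1 : ℤ) + (-1) = -2 ∧ (-1 : ℤ) + (-3) = -4 ∧ (-4 : ℤ) ≤ -3 ∧ (-1 : ℤ) + (-2) = -3) := by
  decide

/-- THE TWO ELEMENTARY INTEGRALS behind "`ε⁴∫_{τ₁}^{+∞} dτ/τ^{3+3δ_dec} ∫_{r≥r₊(1−δ_H)} dr/r^{1+δ} ≲ ε₀²τ₁^{−2−3δ_dec}`" (p.517 L64–75): the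
antiderivative exponent `−(3+3δ_dec) + 1 = −2−3δ_dec` (negative, so the τ-integral converges, for `δ_dec > −2/3`, in particular for
`δ_dec > 0`) and the `r`-integrand exponent `−(1+δ) < −1` iff `δ > 0` (convergence at infinity; the lower limit `r₊(1−δ_H) > 0` needs
`δ_H < 1`).  `ε⁴ ≲ ε₀²` is the bootstrap convention `ε = ε₀^{2/3}` (`AbarDecayInteriorLedger.eps_convention`; not re-proved).
[cite: GiorgiKlainermanSzeftel2024, p.517 L55–75; GiorgiKlainermanSzeftel2022, l.21946–21958] -/
theorem err_integrals (δ δdec δH rplus : ℚ) :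
    (-(3 + 3 * δdec) + 1 = -2 - 3 * δdec) ∧ (0 < δdec → -2 - 3 * δdec < 0) ∧ (-(1 + δ) < -1 ↔ 0 < δ) ∧
    (0 < rplus → δH < 1 → 0 < rplus * (1 - δH)) := by
  refine ⟨by ring, fun h => by linarith, ?_, fun h1 h2 => mul_pos h1 (by linarith)⟩
  constructor <;> intro h <;> linarith

/-! ## §5 §11.4.5 (p.518 L3–p.521 L52; l.21963–22116) and the exponent `min(4, 5−δ−p)` of (11.2.7) -/

/-- §11.4.5, the `Σ`-estimate for `∇₃∇̌₃A` at `s = 0` (p.519 L2–31; l.22014–22029): from "`∇₃∇̌₃A = O(r^{−4})𝔮 + O(r^{−1})∇₃A + O(r^{−2})A`",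
"for any `τ ∈ [τ₁,τ₂]`, for all `δ ≤ p ≤ 1−δ`, `∫_Σ r^{p+6}|∇₃∇̌₃A|² ≲ E_p[𝔮](τ₁,τ₂) + ∫_Σ r^{p+2}(r²|∇₃A|² + |A|²)`": at weight `p+6 = (p+2)+4`
the three terms land at `p+6−8 = p−2` = (6.1.17)'s zeroth-order weight IN THE REGIME `p ≤ 1−δ` (and only there, `sigmaZero_regimes`),
`p+6−2 = p+4 = (p+2)+2` and `p+6−4 = p+2` — the display's last two terms, EXACTLY.
[cite: GiorgiKlainermanSzeftel2024, §11.4.5, p.519 L2–31, (6.1.17), p.219 L75–101; GiorgiKlainermanSzeftel2022, l.22014–22029, l.9946–9951] -/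
theorem s0_sigma33 (p δ : ℚ) :
    (p + 2) + 4 = p + 6 ∧ (p + 6) - 8 = p - 2 ∧ (p + 6) - 2 = (p + 2) + 2 ∧ (p + 6) - 4 = p + 2 ∧
    (p ≤ 1 - δ → sigmaZero δ p = p - 2) ∧ (¬ p ≤ 1 - δ → sigmaZero δ p < p - 2) := by
  refine ⟨by ring, by ring, by ring, by ring, fun h => ((sigmaZero_regimes δ p).2.2.2.1).1 h, fun h => ?_⟩
  simp only [sigmaZero_def]
  have : -1 - δ < p - 2 := by linarith [lt_of_not_ge h]
  rw [min_eq_right this.le]; exact this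

/-- The printed exponent of (11.2.7)'s first slot, "`r^{p+2}·r^{min(4, 5−δ−p)}|∇₃∇̌₃𝔡^{≤s}A|²`" (p.486 L11–21, p.519 L33–48).
[cite: GiorgiKlainermanSzeftel2024, (11.2.7), p.486 L11–21, p.519 L33–48; GiorgiKlainermanSzeftel2022, l.20660–20665, l.22030–22045] -/
def w1127 (δ p : ℚ) : ℚ := min 4 (5 - δ - p)

/-- Unfolding lemma for `w1127`. [cite: GiorgiKlainermanSzeftel2024, (11.2.7), p.486 L11–21] -/
@[simp] lemma w1127_def (δ p : ℚ) : w1127 δ p = min 4 (5 - δ - p) := rfl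

/-- HEADLINE — THE ORIGIN OF `min(4, 5−δ−p)` ("Grouping the above estimates, we infer, … for all `δ ≤ p ≤ 2−δ`", p.519 L33–39; the text
displays the case `p ≤ 1−δ` only, `s0_sigma33`).  Through `|∇₃∇̌₃A| ≲ r^{−4}|𝔮| + …` an inner weight `w` on `Σ` produces the `𝔮`-term
`r^{p+2+w−8}|𝔮|²`, and `E_p[𝔮]`'s zeroth-order `Σ`-weight is `min(p−2, −1−δ)` ((6.1.17), `sigmaZero`).  The printed `w = min(4, 5−δ−p)`
makes the two EQUAL identically in `p` and `δ` — `(p+2) + min(4, 5−δ−p) − 8 = min(p−2, −1−δ)` — i.e. it is, in both regimes of (6.1.17)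
at once, exactly the weight `E_p[𝔮]` affords, with nothing spare.
[cite: GiorgiKlainermanSzeftel2024, (11.2.7), p.486 L11–21, §11.4.5, p.519 L2–48, (6.1.17), p.219 L75–101; GiorgiKlainermanSzeftel2022, l.20660–20665, l.22014–22045, l.9946–9951] -/
theorem w1127_origin (δ p : ℚ) : (p + 2) + w1127 δ p - 8 = sigmaZero δ p := by
  simp only [w1127_def, sigmaZero_def]
  rcases le_total (4 : ℚ) (5 - δ - p) with h | h
  · rw [min_eq_left h, min_eq_left (by linarith : p - 2 ≤ -1 - δ)]; ring
  · rw [min_eq_right h, min_eq_right (by linarith : -1 - δ ≤ p - 2)]; ring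

/-- MAXIMALITY and the REGIMES: an inner weight `w` keeps the `𝔮`-term inside `E_p[𝔮]` (`p+2+w−8 ≤ min(p−2, −1−δ)`) iff `w ≤ min(4, 5−δ−p)`;
the printed exponent equals `4` iff `p ≤ 1−δ` and `5−δ−p` iff `1−δ ≤ p` — the crossover is (6.1.17)'s `p = 1−δ`; in the second regime
the total weight `(p+2) + (5−δ−p) = 7−δ` does not depend on `p`; at the endpoints of Proposition 11.2.9's range, `w = 4` at `p = δ`
(given `δ ≤ 1/2`) and `w = 3` at `p = 2−δ`; and `w ≤ 4` always, so (11.2.7)'s first slot never exceeds the bulk-type offset `6 = 5+1`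
of slot 4 (`normB`).
[cite: GiorgiKlainermanSzeftel2024, (11.2.7), p.486 L5–21, p.519 L13–48, (6.1.17), p.219 L75–101; GiorgiKlainermanSzeftel2022, l.20650–20665, l.22026–22045] -/
theorem w1127_max (δ p : ℚ) :
    (∀ w : ℚ, (p + 2) + w - 8 ≤ sigmaZero δ p ↔ w ≤ w1127 δ p) ∧
    ((p ≤ 1 - δ ↔ w1127 δ p = 4) ∧ (1 - δ ≤ p ↔ w1127 δ p = 5 - δ - p)) ∧
    ((p + 2) + (5 - δ - p) = 7 - δ) ∧ (δ ≤ 1 / 2 → w1127 δ δ = 4) ∧ w1127 δ (2 - δ) = 3 ∧ (w1127 δ p ≤ 4 ∧ (4, (5 : ℤ)) ∈ normB) := by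
  simp only [w1127_def, sigmaZero_def]
  refine ⟨fun w => ?_, ⟨?_, ?_⟩, by ring, fun h => min_eq_left (by linarith), ?_, ⟨min_le_left _ _, by decide⟩⟩
  · simp only [le_min_iff]
    constructor <;> rintro ⟨h1, h2⟩ <;> constructor <;> linarith
  · constructor
    · intro h; exact min_eq_left (by linarith)
    · intro h; have := min_le_right (4 : ℚ) (5 - δ - p); rw [h] at this; linarith
  · constructor
    · intro h; exact min_eq_right (by linarith)
    · intro h; have := min_le_left (4 : ℚ) (5 - δ - p); rw [h] at this; linarith
  · rw [min_eq_right (by linarith)]; ring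

/-- `w1127_regimes`: the same dichotomy phrased on the TOTAL `Σ`-weight of (11.2.7)'s first slot, `(p+2) + min(4, 5−δ−p) = min(p+6, 7−δ)`:
it is the case-`p ≤ 1−δ` display's `p+6` (p.519 L13–31) on the first regime and the constant `7−δ` on the second; and `7−δ` is ALSO the
bulk weight `r^{7−δ}` that Lemma 11.4.14 prints for `Err_{∇A}` (a coincidence of numbers recorded only as such: `(2−δ)+5 = 7−δ`).
[cite: GiorgiKlainermanSzeftel2024, p.519 L13–48, p.517 L55–62; GiorgiKlainermanSzeftel2022, l.22026–22037, l.21946–21950] -/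
theorem w1127_regimes (δ p : ℚ) :
    (p + 2) + w1127 δ p = min (p + 6) (7 - δ) ∧ (p ≤ 1 - δ → min (p + 6) (7 - δ) = p + 6) ∧
    (1 - δ ≤ p → min (p + 6) (7 - δ) = 7 - δ) ∧ (2 - δ) + 5 = 7 - δ := by
  simp only [w1127_def]
  refine ⟨?_, fun h => min_eq_left (by linarith), fun h => min_eq_right (by linarith), by ring⟩
  rcases le_total (4 : ℚ) (5 - δ - p) with h | h
  · rw [min_eq_left h, min_eq_left (by linarith : p + 6 ≤ 7 - δ)]; ring
  · rw [min_eq_right h, min_eq_right (by linarith : 7 - δ ≤ p + 6)]; ring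

/-- §11.4.5, first part (p.518 L9–44; l.21968–21998): "`F_p[A] = Ḟ_p[A]`, `E_p[A] = Ė_p[A]` and `B_p[A] = Ḃ_p[A] + ∫ r^{p+3}(r²|∇∇₃A|² + |∇A|²)`"
— on the tables the first two are identities of [v1]'s Definition l.21338–21341 with Definition 11.2.1 (same integrand; in [J] the dotted
symbols are undefined, module docstring) and the third is `b_split`; the two inputs "`∫ r^{p+3}(r²|∇∇₃A|² + |∇A|²) ≲ B_p[𝔮] + Ḃ_p[A] +
ε₀²τ₁^{−2−3δ_dec}`" (Corollary 11.4.13 + Lemma 11.4.14, p.518 L9–13) and (11.4.10)'s conditional term carry the SAME two weights `p+5`, `p+3`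
(slots 6, 3), so "using the smallness of `ε` and `a`" (L26) absorbs weight for weight; and on `Σ` (p.518 L45–49) `r^{p+2}(r⁴|∇∇₃A|² +
r²|∇A|²)` = offsets `6, 4` = (11.2.7)'s slots 6, 3.
[cite: GiorgiKlainermanSzeftel2024, §11.4.5, p.518 L9–49, (11.4.10), p.502 L72–83; GiorgiKlainermanSzeftel2022, l.21968–22013] -/
theorem s0_assembly (p : ℚ) :
    ((p + 3) + 2 = p + 5 ∧ (p + 3) + 0 = p + 3 ∧ (p + 2) + 4 = p + 6 ∧ (p + 2) + 2 = p + 4) ∧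
    (extraB = {(6, 5), (3, 3)} ∧ ((6, (6 : ℤ)) ∈ norm1127rest ∧ (3, (4 : ℤ)) ∈ norm1127rest) ∧ normE = normE) := by
  refine ⟨⟨by ring, by ring, by ring, by ring⟩, rfl, by decide, rfl⟩

/-- §11.4.5, the ITERATION `s → s+1` (p.519 L49–p.521 L52; l.22052–22116): the systems commuted with `𝓛̸_T`, `q𝒟̄·`, `∇̌₄` keep the shape of
(11.4.8) with the printed extra sources "`(O(r^{−3}) + r^{−2}𝔡^{≤1}Γ_b)𝔮`" (next to `O(r^{−2})` × the commuted `𝔮`), "`O(ar^{−2})∇Ψ +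
O(r^{−3})Ψ`" (from "`[∇̌₃,∇̌₄]U = O(ar^{−2})∇U + O(r^{−3})U + …`") and, in the `A`-equations, "`O(a)∇A + O(r^{−1})A`", "`O(ar)∇̌₃A + O(a)A`".
At the levels of §2 (`p+2` for the `Ψ`-equations, `p` for the `A`-equations) each lands AT OR BELOW a weight already in the tables:
`r^{p+1−6}|𝔮|² = r^{p−5}` (two below (6.1.16)'s `p−3`); `a²r^{p+1−4}|∇Ψ|² = a²r^{p−3}` (four below the conditional `r^{p+1}|∇Ψ|²`);
`r^{p+1−6}|Ψ|²` (four below the bulk `p−1`); in the `A`-equations, `Φ₂ ∋ O(a)∇A` at source weight `p−1` gives `a²r^{p−1}|∇A|²`,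
four below slot 3's `p+3`; `O(r^{−1})A` gives `r^{p−3}|A|²`, four below slot 0; `O(ar)∇̌₃A` gives `a²r^{p+1}|∇₃A|²`,
two below slot 1; `O(a)A` gives `a²r^{p−1}|A|²`, two below slot 0 [the slack counts are ours; the orders are the printed ones].
[cite: GiorgiKlainermanSzeftel2024, §11.4.5, p.519 L49–p.521 L52; GiorgiKlainermanSzeftel2022, l.22052–22116] -/
theorem iteration_sources (p : ℚ) :
    (wSrc (p + 2) - 6 = bPsiZero p - 2 ∧ wSrc (p + 2) - 4 = (p + 1) - 4 ∧ wSrc (p + 2) - 6 = wBulk (p + 2) - 4) ∧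
    (wSrc p + 0 = (p + 3) - 4 ∧ wSrc p - 2 = (p + 1) - 4 ∧ wSrc p + 2 = (p + 3) - 2 ∧ wSrc p + 0 = (p + 1) - 2) := by
  simp only [wSrc_def, wBulk_def, bPsiZero_def]
  refine ⟨⟨by ring, by ring, by ring⟩, ⟨by ring, by ring, by ring, by ring⟩⟩

/-- SUMMARY of the print data with arithmetic content, as one statement: (W1) the displayed weights of Lemma 11.4.1's proof are those of
template level `p+2`, one above the printed "`p+1`", and both levels are admissible for `p ≥ δ`; (W2) `5/r = 5/r⁵` only if `r⁴ = 1`, while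
`(5/r)(1/r⁴) = 5/r⁵` and `5 − 4 = 1` reproduce the next display; and the headline identity of (11.2.7).  None affects Proposition 11.2.9.
[cite: GiorgiKlainermanSzeftel2024, p.500 L59–91, p.510 L22–96, p.511 L12–45, (11.2.7), p.486 L11–21; GiorgiKlainermanSzeftel2022, l.21268–21277, l.21620–21670, l.20660–20665] -/
theorem print_data_transport (p δ : ℚ) (r : ℝ) (hr : r ≠ 0) (hr1 : r ^ 4 ≠ 1) :
    (wBulk (p + 2) = wBulk p + 2 ∧ wBulk (p + 1) + 1 = wBulk (p + 2) ∧ (δ ≤ p → δ < p + 1 ∧ δ < p + 2)) ∧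
    ((5 : ℝ) / r ≠ 5 / r ^ 5 ∧ (5 : ℝ) / r * (1 / r ^ 4) = 5 / r ^ 5 ∧ (5 : ℝ) - 4 = 1) ∧
    (p + 2) + w1127 δ p - 8 = sigmaZero δ p := by
  refine ⟨⟨by simp only [wBulk_def]; ring, by simp only [wBulk_def]; ring, fun h => ⟨by linarith, by linarith⟩⟩,
    ⟨fun h => hr1 (((W2_coefficient r 0 hr).2.2.2.2.2).1 h), (W2_coefficient r 0 hr).1, by norm_num⟩, w1127_origin δ p⟩

end Literature.Geometry.Lorentzian.GiorgiKlainermanSzeftel2022.TransportWeightLedger
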